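import Literature.Probability.RandomPlanarGeometry.SAWBridgeRenewalDensity
import Literature.Probability.RandomPlanarGeometry.SAWBridgeRenewalEquation
import HarnessLib

/-!
# Sparse levels and renewal points of high bridges: Duminil-Copin–Hammond 2013, Theorem 3.1 from Proposition 3.2

Topic `Literature/Probability/RandomPlanarGeometry` (continues `SAWSubBallistic.lean` (`Zd.IsRenewalTime`, bridges),
`SAWBridgeRenewalDensity.lean` (`Zd.renewalCount`)).

Source: H. Duminil-Copin, A. Hammond, *Self-avoiding walk is sub-ballistic*, Comm. Math. Phys. 324 (2013)
401–423, arXiv:1205.0401 [DuminilCopinHammond2013], §3 (arXiv v1, pp. 11–12; the `Lk` locators in this paragraph are lines of chunk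
p0008 of the held lit-store text `paper:arxiv-1205.0401`, a finding aid, not PDF lines). Objects (L9–18): `SAB_{n,v} = {γ ∈ SAB_n :
y(γ_n) ≥ vn}` (3.1); `V_{h,h+1}(γ) = E_h ∩ {(γ_i, γ_{i+1})}` the steps between heights `h` and `h+1`;
`SAB^m_{n,v,δ}` = the `γ ∈ SAB_{n,v}` with at least `δn` levels `h` for which `|V_{h,h+1}| ≤ m`.
**Theorem 3.1** (L10–13): "Let `v > 0`. Let `{u_n}` be a subsequence of `ℕ`. There exists `δ > 0` as well as a
subsequence `{v_n}` of `{u_n}` and a sequence `ε_n ↘ 0` such that `P_{SAB_{v_n,v}}(|R_γ| ≥ δ v_n) ≥ e^{−ε_n v_n}`."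
**Proposition 3.2** (L24–28): "Let `v > 0`, `k ≥ 2`, `δ > 0` and `{u_n}` a subsequence of `ℕ`. Then there exist
`δ' > 0` and a subsequence `{v_n}` of `{u_n}` such that `lim (1/v_n) log(|SAB^k_{v_n,v,δ}| / |SAB^{k−1}_{v_n,v,δ'}|)
= 0`." Proof of Theorem 3.1 from Proposition 3.2 (L37–47): the inclusion `SAB_{n,v} ⊆ SAB^{⌈2/v⌉}_{n,v,v/2}` (3.2)
by pigeonhole, `⌈2/v⌉ − 1` applications of the proposition, and "if `V_{h,h+1}` has only one element `e`, then
the endpoint `u` of `e` with `y(u) = h` belongs to `R_γ`".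

This file (objects typed by a-idea-2, lane pcv-sawmu, skeleton `Sketch_v8_DCH11`; `y` = coordinate `0`):
* `Zd.highBridges d n v` (`SAB_{n,v}`), `Zd.levelVisits n ω h` (`|V_{h,h+1}(ω)|`), `Zd.sparseLevelCount m n ω`
  (number of levels `0 ≤ h < y(ω_n)` with `|V_{h,h+1}| ≤ m` — READING NOTE: the printed "values of `h ∈ ℤ`" is
  read over the levels below the top, since every far-away level has `|V| = 0 ≤ m`), `Zd.sparseHighBridges d n v δ m`
  (`SAB^m_{n,v,δ}`);
* `Zd.DCH_prop32` — Proposition 3.2 in the ONE-SIDED MULTIPLICATIVE form that is used downstream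
  (`|SAB^k_{v_n,v,δ}| ≤ e^{ε_n v_n} |SAB^{k−1}_{v_n,v,δ'}|`, `ε_n → 0`; no `log`/division junk values), with
  subsequences as `StrictMono` maps; `Zd.DCH_thm31` — Theorem 3.1 with `ε_n → 0` (monotonicity of `ε_n` is never
  used); `Zd.Thm31_of_prop32` — the skeleton node;
* lemmas: `Zd.sum_levelVisits_le` (`Σ_h |V_{h,h+1}| ≤ n`), `Zd.one_le_levelVisits` (a bridge crosses every level
  below its top), `Zd.exists_isRenewalTime_of_levelVisits_le_one` and `Zd.sparseLevelCount_one_le_renewalCount`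
  (`SAB^1_{n,v,δ} ⊆ {|R_γ| ≥ δn}`), `Zd.highBridges_subset_sparseHighBridges` (= (3.2));
* **`Zd.thm31_of_prop32 : DCH_prop32 → DCH_thm31`** (`Zd.thm31_of_prop32_holds : Thm31_of_prop32`).
Proposition 3.2 itself (the zigzag-unfolding count, §3 pp. 8–11) is NOT proved here.
-/

noncomputable section

open Finset Filter Topology Literature.Probability.LatticeModels Literature.Probability.Percolation
open scoped BigOperators

namespace Literature.Probability.RandomPlanarGeometry.SAW.Zd

open Classical in
/-- `SAB_{n,v} = {γ ∈ SAB_n : y(γ_n) ≥ v n}`. [cite: DuminilCopinHammond2013, §3, eq. (3.1) (arXiv v1, p. 11)] -/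
def highBridges (d : ℕ) [NeZero d] (n : ℕ) (v : ℝ) : Finset (ℕ → Site d) :=
  (bridges d n).filter fun ω => v * (n : ℝ) ≤ ((ω n 0 : ℤ) : ℝ)

open Classical in
/-- `|V_{h,h+1}(γ)|`: the number of steps `(γ_i, γ_{i+1})`, `0 ≤ i < n`, whose heights are `{h, h+1}`.
[cite: DuminilCopinHammond2013, §3 (arXiv v1, p. 11)] -/
def levelVisits {d : ℕ} [NeZero d] (n : ℕ) (ω : ℕ → Site d) (h : ℤ) : ℕ :=
  ((Finset.range n).filter fun i =>
    (ω i 0 = h ∧ ω (i + 1) 0 = h + 1) ∨ (ω i 0 = h + 1 ∧ ω (i + 1) 0 = h)).card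

open Classical in
/-- Number of levels `0 ≤ h < y(γ_n)` with `|V_{h,h+1}(γ)| ≤ m`. [cite: DuminilCopinHammond2013, §3 (arXiv v1, p. 11)] -/
def sparseLevelCount {d : ℕ} [NeZero d] (m n : ℕ) (ω : ℕ → Site d) : ℕ :=
  ((Finset.range (ω n 0).toNat).filter fun h : ℕ => levelVisits n ω (h : ℤ) ≤ m).card

open Classical in
/-- `SAB^m_{n,v,δ}`: bridges in `SAB_{n,v}` with at least `δ n` levels `h` such that `|V_{h,h+1}| ≤ m`.
[cite: DuminilCopinHammond2013, §3 (arXiv v1, p. 11)] -/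
def sparseHighBridges (d : ℕ) [NeZero d] (n : ℕ) (v δ : ℝ) (m : ℕ) : Finset (ℕ → Site d) :=
  (highBridges d n v).filter fun ω => δ * (n : ℝ) ≤ (sparseLevelCount m n ω : ℝ)

/-- **Proposition 3.2** as used (one-sided multiplicative form along a subsequence).
[cite: DuminilCopinHammond2013, Prop 3.2 (arXiv v1, p. 11)] -/
def DCH_prop32 : Prop :=
  ∀ (d : ℕ) [NeZero d], 2 ≤ d → ∀ v : ℝ, 0 < v → ∀ k : ℕ, 2 ≤ k → ∀ δ : ℝ, 0 < δ →
    ∀ u : ℕ → ℕ, StrictMono u →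
      ∃ δ' : ℝ, 0 < δ' ∧ ∃ φ : ℕ → ℕ, StrictMono φ ∧ ∃ ε : ℕ → ℝ, Tendsto ε atTop (𝓝 0) ∧
        ∀ n : ℕ, ((sparseHighBridges d (u (φ n)) v δ k).card : ℝ) ≤
          Real.exp (ε n * (u (φ n) : ℝ)) * ((sparseHighBridges d (u (φ n)) v δ' (k - 1)).card : ℝ)

open Classical in
/-- **Theorem 3.1** (positive density of renewal points at subexponential cost, along a subsequence).
[cite: DuminilCopinHammond2013, Thm 3.1 (arXiv v1, p. 11)] -/
def DCH_thm31 : Prop :=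
  ∀ (d : ℕ) [NeZero d], 2 ≤ d → ∀ v : ℝ, 0 < v → ∀ u : ℕ → ℕ, StrictMono u →
    ∃ δ : ℝ, 0 < δ ∧ ∃ φ : ℕ → ℕ, StrictMono φ ∧ ∃ ε : ℕ → ℝ, Tendsto ε atTop (𝓝 0) ∧
      ∀ n : ℕ, ((highBridges d (u (φ n)) v).card : ℝ) ≤
        Real.exp (ε n * (u (φ n) : ℝ)) *
          (((highBridges d (u (φ n)) v).filter fun ω =>
              δ * (u (φ n) : ℝ) ≤ (renewalCount (u (φ n)) ω : ℝ)).card : ℝ)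

variable {d : ℕ} [NeZero d]

/-! ### Height steps of a lattice walk -/

/-- Adjacent sites differ by at most one in height. [cite: MadrasSlade1993, §1.2] -/
theorem abs_sub_apply_zero_le_one_of_adj {x y : Site d} (h : (zdGraph d).Adj x y) : |y 0 - x 0| ≤ 1 := by
  rw [zdGraph_adj_iff_sub] at h
  obtain ⟨c, hc | hc⟩ := h
  · have := congrFun hc 0
    simp only [Pi.sub_apply] at this
    rw [this]
    by_cases h0 : c = 0
    · subst h0; simp
    · rw [Pi.single_eq_of_ne (Ne.symm h0)]; simp
  · have := congrFun hc 0
    simp only [Pi.sub_apply] at this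
    rw [abs_sub_comm, this]
    by_cases h0 : c = 0
    · subst h0; simp
    · rw [Pi.single_eq_of_ne (Ne.symm h0)]; simp

/-- First up-crossing of the gap `(g, g+1)` of a `1`-Lipschitz integer sequence. [cite: DuminilCopinHammond2013, §3 (arXiv v1, p. 11: a bridge crosses every level below its top)] -/
theorem exists_upcross' {y : ℕ → ℤ} {a b : ℕ} (hab : a ≤ b) (hstep : ∀ t, a ≤ t → t < b → |y (t + 1) - y t| ≤ 1)
    {g : ℤ} (hlo : y a ≤ g) (hhi : g + 1 ≤ y b) :
    ∃ t, a ≤ t ∧ t < b ∧ y t = g ∧ y (t + 1) = g + 1 := by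
  classical
  have hex : ∃ s, a ≤ s ∧ s ≤ b ∧ g + 1 ≤ y s := ⟨b, hab, le_rfl, hhi⟩
  obtain ⟨hs1, hs2, hs3⟩ := Nat.find_spec hex
  have hmin : ∀ s', s' < Nat.find hex → ¬ (a ≤ s' ∧ s' ≤ b ∧ g + 1 ≤ y s') := fun s' hs' => Nat.find_min hex hs'
  set s := Nat.find hex with hs
  have hsa : s ≠ a := by
    rintro h
    rw [h] at hs3
    omega
  obtain ⟨t, ht⟩ : ∃ t, s = t + 1 := ⟨s - 1, by omega⟩
  have ht1 : ¬ (g + 1 ≤ y t) := fun h => hmin t (by omega) ⟨by omega, by omega, h⟩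
  have hst := hstep t (by omega) (by omega)
  rw [ht] at hs3
  refine ⟨t, by omega, by omega, ?_, ?_⟩
  · have := abs_le.1 hst; omega
  · have := abs_le.1 hst; omega

/-- First down-crossing of the gap `(g, g+1)`. [cite: DuminilCopinHammond2013, §3 (arXiv v1, p. 11)] -/
theorem exists_downcross' {y : ℕ → ℤ} {a b : ℕ} (hab : a ≤ b) (hstep : ∀ t, a ≤ t → t < b → |y (t + 1) - y t| ≤ 1)
    {g : ℤ} (hhi : g + 1 ≤ y a) (hlo : y b ≤ g) :
    ∃ t, a ≤ t ∧ t < b ∧ y t = g + 1 ∧ y (t + 1) = g := by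
  have hstep' : ∀ t, a ≤ t → t < b → |(-y (t + 1)) - (-y t)| ≤ 1 := by
    intro t h1 h2
    rw [show -y (t + 1) - -y t = -(y (t + 1) - y t) by ring, abs_neg]
    exact hstep t h1 h2
  obtain ⟨t, h1, h2, h3, h4⟩ := exists_upcross' (y := fun i => -y i) hab hstep' (g := -(g + 1))
    (show -y a ≤ -(g + 1) by omega) (show -(g + 1) + 1 ≤ -y b by omega)
  exact ⟨t, h1, h2, by omega, by omega⟩

/-! ### Level visits -/

section Levels

variable {n : ℕ} {ω : ℕ → Site d}

open Classical in
/-- The step sets counted by `levelVisits` at distinct levels are disjoint, hence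
`Σ_{h ∈ S} |V_{h,h+1}| ≤ n` for every finite set `S` of levels. [cite: DuminilCopinHammond2013, proof of Thm 3.1 (arXiv v1, p. 11: "|V_{h,h+1}| can be larger than 2/v on at most vn/2 occasions")] -/
theorem sum_levelVisits_le (S : Finset ℤ) : ∑ h ∈ S, levelVisits n ω h ≤ n := by
  unfold levelVisits
  rw [← card_biUnion]
  · exact (card_le_card (biUnion_subset.2 fun h _ => filter_subset _ _)).trans (card_range n).le
  · intro h _ h' _ hne
    rw [Function.onFun, disjoint_filter]
    intro i _ hi hi'
    rcases hi with ⟨h1, h2⟩ | ⟨h1, h2⟩ <;> rcases hi' with ⟨h1', h2'⟩ | ⟨h1', h2'⟩ <;> omega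

/-- Every level below the top of a bridge is crossed: `|V_{h,h+1}(γ)| ≥ 1` for `0 ≤ h < y(γ_n)`.
[cite: DuminilCopinHammond2013, proof of Thm 3.1 (arXiv v1, p. 11: "V_{h,h+1} ≠ ∅ for at least vn values of h")] -/
theorem one_le_levelVisits (hω : ω ∈ bridges d n) {h : ℤ} (h0 : 0 ≤ h) (hh : h < ω n 0) :
    1 ≤ levelVisits n ω h := by
  classical
  obtain ⟨hs, -⟩ := mem_bridges.1 hω
  obtain ⟨hω0, -, hadj, -⟩ := mem_saws.1 hs
  obtain ⟨t, -, htn, ht1, ht2⟩ := exists_upcross' (y := fun i => ω i 0) (Nat.zero_le n)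
    (fun t _ ht => abs_sub_apply_zero_le_one_of_adj (hadj t ht)) (g := h) (by simp [hω0]; exact h0) (by omega)
  unfold levelVisits
  rw [Nat.one_le_iff_ne_zero, Ne, card_eq_zero, ← Ne, ← nonempty_iff_ne_empty]
  exact ⟨t, mem_filter.2 ⟨mem_range.2 htn, Or.inl ⟨ht1, ht2⟩⟩⟩

/-- **A level crossed exactly once is crossed at a renewal time**: if `|V_{h,h+1}(γ)| ≤ 1` for a level
`0 ≤ h < y(γ_n)` of a bridge `γ`, then the (unique, upward) crossing time `i` (`y(γ_i) = h`) is a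
renewal time. [cite: DuminilCopinHammond2013, proof of Thm 3.1 (arXiv v1, pp. 11–12: "if V_{h,h+1} has only one element e, then the endpoint u of e with y(u) = h belongs to R_γ")] -/
theorem exists_isRenewalTime_of_levelVisits_le_one (hω : ω ∈ bridges d n) {h : ℤ} (h0 : 0 ≤ h)
    (hh : h < ω n 0) (h1 : levelVisits n ω h ≤ 1) :
    ∃ i, i < n ∧ ω i 0 = h ∧ IsRenewalTime n ω i := by
  classical
  obtain ⟨hs, hbr⟩ := mem_bridges.1 hω
  obtain ⟨hω0, -, hadj, -⟩ := mem_saws.1 hs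
  have hstep : ∀ t, 0 ≤ t → t < n → |ω (t + 1) 0 - ω t 0| ≤ 1 :=
    fun t _ ht => abs_sub_apply_zero_le_one_of_adj (hadj t ht)
  obtain ⟨i, -, hin, hi1, hi2⟩ := exists_upcross' (y := fun i => ω i 0) (Nat.zero_le n) hstep (g := h)
    (by simp [hω0]; exact h0) (by omega)
  -- any other crossing of the gap would be a second element of `V_{h,h+1}`
  have huniq : ∀ t, t < n → ((ω t 0 = h ∧ ω (t + 1) 0 = h + 1) ∨ (ω t 0 = h + 1 ∧ ω (t + 1) 0 = h)) → t = i := by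
    intro t ht hcross
    by_contra hne
    have h2 : 2 ≤ levelVisits n ω h := by
      unfold levelVisits
      have hsub : ({t, i} : Finset ℕ) ⊆ (range n).filter fun i =>
          (ω i 0 = h ∧ ω (i + 1) 0 = h + 1) ∨ (ω i 0 = h + 1 ∧ ω (i + 1) 0 = h) := by
        intro x hx
        rw [mem_insert, mem_singleton] at hx
        rw [mem_filter, mem_range]
        rcases hx with rfl | rfl
        · exact ⟨ht, hcross⟩
        · exact ⟨hin, Or.inl ⟨hi1, hi2⟩⟩
      have := card_le_card hsub
      rwa [card_pair hne] at this
    omega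
  refine ⟨i, hin, hi1, ⟨hin.le, fun j hj1 hji => ⟨?_, ?_⟩, fun k hk1 hk2 => ⟨?_, ?_⟩⟩⟩
  · exact (hbr j hj1 (by omega)).1
  · -- heights before `i` stay `≤ h`
    by_contra hlt
    push Not at hlt
    rw [hi1] at hlt
    obtain ⟨t, htj, hti, ht1, ht2⟩ := exists_downcross' (y := fun i => ω i 0) hji
      (fun t _ ht => hstep t (Nat.zero_le _) (by omega)) (g := h) (show h + 1 ≤ ω j 0 by omega)
      (show ω i 0 ≤ h by omega)
    have := huniq t (by omega) (Or.inr ⟨ht1, ht2⟩)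
    omega
  · -- heights after `i` stay `> h`
    show ω (i + 0) 0 < ω (i + k) 0
    rw [add_zero]
    by_contra hle
    push Not at hle
    rw [hi1] at hle
    have hk : i + 1 ≤ i + k := by omega
    obtain ⟨t, htj, hti, ht1, ht2⟩ := exists_downcross' (y := fun i => ω i 0) hk
      (fun t _ ht => hstep t (Nat.zero_le _) (by omega)) (g := h) (show h + 1 ≤ ω (i + 1) 0 by omega)
      (show ω (i + k) 0 ≤ h from hle)
    have := huniq t (by omega) (Or.inr ⟨ht1, ht2⟩)
    omega
  · show ω (i + k) 0 ≤ ω (i + (n - i)) 0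
    rw [show i + (n - i) = n by omega]
    exact (hbr (i + k) (by omega) (by omega)).2

/-- **`SAB^1_{n,v,δ} ⊆ {|R_γ| ≥ δn}`** in the form `sparseLevelCount 1 n γ ≤ renewalCount n γ`: distinct
singly-crossed levels give distinct renewal times. [cite: DuminilCopinHammond2013, proof of Thm 3.1 (arXiv v1, p. 12)] -/
theorem sparseLevelCount_one_le_renewalCount (hω : ω ∈ bridges d n) :
    sparseLevelCount 1 n ω ≤ renewalCount n ω := by
  classical
  unfold sparseLevelCount renewalCount
  -- choose the crossing time of each singly-crossed level
  have key : ∀ h ∈ (range (ω n 0).toNat).filter (fun h : ℕ => levelVisits n ω (h : ℤ) ≤ 1),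
      ∃ i, i < n ∧ ω i 0 = (h : ℤ) ∧ IsRenewalTime n ω i := by
    intro h hh
    rw [mem_filter, mem_range] at hh
    have : (h : ℤ) < ω n 0 := by
      have := hh.1
      omega
    exact exists_isRenewalTime_of_levelVisits_le_one hω (by positivity) this hh.2
  choose! f hf using key
  refine card_le_card_of_injOn f (fun h hh => ?_) (fun h hh h' hh' hff => ?_)
  · rw [mem_coe] at hh
    rw [mem_coe, mem_filter, mem_range]
    exact ⟨Nat.lt_succ_of_lt (hf h hh).1, (hf h hh).2.2⟩
  · rw [mem_coe] at hh hh'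
    have h1 := (hf h hh).2.1
    have h2 := (hf h' hh').2.1
    rw [hff] at h1
    rw [h1] at h2
    exact_mod_cast h2

/-- **Inclusion (3.2) by pigeonhole**: `SAB_{n,v} ⊆ SAB^{⌈2/v⌉}_{n,v,v/2}` — among the `≥ vn` levels below
the top of a high bridge, `|V_{h,h+1}|` exceeds `2/v` on at most `vn/2` of them since `Σ_h |V_{h,h+1}| ≤ n`.
[cite: DuminilCopinHammond2013, proof of Thm 3.1, eq. (3.2) (arXiv v1, p. 11)] -/
theorem highBridges_subset_sparseHighBridges {v : ℝ} (hv : 0 < v) (n : ℕ) :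
    highBridges d n v ⊆ sparseHighBridges d n v (v / 2) ⌈2 / v⌉₊ := by
  classical
  intro ω hω
  rw [sparseHighBridges, mem_filter]
  refine ⟨hω, ?_⟩
  rw [highBridges, mem_filter] at hω
  obtain ⟨hωb, hvn⟩ := hω
  set m := ⌈2 / v⌉₊ with hm
  set H := (ω n 0).toNat with hH
  have hH0 : ((H : ℕ) : ℤ) = ω n 0 := Int.toNat_of_nonneg (by
    have : (0 : ℝ) ≤ ((ω n 0 : ℤ) : ℝ) := le_trans (by positivity) hvn
    exact_mod_cast this)
  set Good := (range H).filter fun h : ℕ => levelVisits n ω (h : ℤ) ≤ m with hGood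
  set Bad := (range H).filter fun h : ℕ => ¬ levelVisits n ω (h : ℤ) ≤ m with hBad
  have hsplit : #Good + #Bad = H := by
    rw [hGood, hBad, Finset.card_filter_add_card_filter_not, card_range]
  -- the bad levels use at least `m + 1` steps each
  have hbad : (m + 1) * #Bad ≤ n := by
    have h1 : (m + 1) * #Bad ≤ ∑ h ∈ Bad, levelVisits n ω (h : ℤ) := by
      rw [mul_comm, ← smul_eq_mul, ← sum_const]
      exact sum_le_sum fun h hh => by rw [hBad, mem_filter] at hh; omega
    have h2 : ∑ h ∈ Bad, levelVisits n ω (h : ℤ) = ∑ h ∈ Bad.map ⟨((↑) : ℕ → ℤ), Nat.cast_injective⟩,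
        levelVisits n ω h := by rw [sum_map]; rfl
    exact h1.trans (h2 ▸ sum_levelVisits_le _)
  -- arithmetic: `#Good ≥ H - n/(m+1) ≥ vn - vn/2`
  have hm2 : 2 / v ≤ m := Nat.le_ceil _
  have hmv : (1 : ℝ) / (m + 1) ≤ v / 2 := by
    rw [div_le_div_iff₀ (by positivity) (by positivity)]
    have : 2 ≤ (m : ℝ) * v := by rwa [div_le_iff₀ hv] at hm2
    nlinarith
  have hBadR : (#Bad : ℝ) ≤ n / (m + 1) := by
    rw [le_div_iff₀ (by positivity)]
    have : (((m + 1) * #Bad : ℕ) : ℝ) ≤ n := by exact_mod_cast hbad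
    push_cast at this
    linarith
  have hHR : v * n ≤ (H : ℝ) := by
    have : ((ω n 0 : ℤ) : ℝ) = (H : ℝ) := by rw [← hH0]; simp
    rw [← this]; exact hvn
  have hGoodR : (#Good : ℝ) = H - #Bad := by
    have : ((#Good + #Bad : ℕ) : ℝ) = H := by exact_mod_cast hsplit
    push_cast at this
    linarith
  show v / 2 * (n : ℝ) ≤ (sparseLevelCount m n ω : ℝ)
  rw [sparseLevelCount, ← hH, ← hGood, hGoodR]
  have : (n : ℝ) / (m + 1) ≤ v / 2 * n := by
    rw [div_eq_mul_one_div, mul_comm]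
    exact mul_le_mul_of_nonneg_right hmv (by positivity)
  linarith

end Levels

/-! ### Theorem 3.1 from Proposition 3.2 -/

/-- **K2: Theorem 3.1 from Proposition 3.2** — inclusion (3.2), `⌈2/v⌉ − 1` applications of Proposition
3.2 along nested subsequences (the subexponential factors add up, re-indexed along the later extractions),
and `SAB^1_{n,v,δ} ⊆ {|R_γ| ≥ δ n}`. [cite: DuminilCopinHammond2013, proof of Thm 3.1 (arXiv v1, pp. 11–12)] -/
theorem thm31_of_prop32 (hP : DCH_prop32) : DCH_thm31 := by
  classical
  intro d _ hd v hv u hu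
  set m := ⌈2 / v⌉₊ with hm
  -- the induction predicate
  have iter : ∀ j : ℕ, j + 1 ≤ m →
      ∃ δ' : ℝ, 0 < δ' ∧ ∃ φ : ℕ → ℕ, StrictMono φ ∧ ∃ ε : ℕ → ℝ, Tendsto ε atTop (𝓝 0) ∧
        ∀ n : ℕ, ((sparseHighBridges d (u (φ n)) v (v / 2) m).card : ℝ) ≤
          Real.exp (ε n * (u (φ n) : ℝ)) * ((sparseHighBridges d (u (φ n)) v δ' (m - j)).card : ℝ) := by
    intro j
    induction j with
    | zero =>
      intro _
      refine ⟨v / 2, by positivity, id, strictMono_id, fun _ => 0, tendsto_const_nhds, fun n => ?_⟩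
      simp
    | succ j ih =>
      intro hj
      obtain ⟨δ', hδ', φ, hφ, ε, hε, hbound⟩ := ih (by omega)
      obtain ⟨δ'', hδ'', φ', hφ', ε', hε', hbound'⟩ :=
        hP d hd v hv (m - j) (by omega) δ' hδ' (u ∘ φ) (hu.comp hφ)
      refine ⟨δ'', hδ'', φ ∘ φ', hφ.comp hφ', fun n => ε (φ' n) + ε' n,
        by simpa using (hε.comp hφ'.tendsto_atTop).add hε', fun n => ?_⟩
      have h1 := hbound (φ' n)
      have h2 := hbound' n
      simp only [Function.comp_apply] at h2 ⊢
      rw [show m - j - 1 = m - (j + 1) by omega] at h2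
      calc ((sparseHighBridges d (u (φ (φ' n))) v (v / 2) m).card : ℝ)
          ≤ Real.exp (ε (φ' n) * (u (φ (φ' n)) : ℝ)) *
              ((sparseHighBridges d (u (φ (φ' n))) v δ' (m - j)).card : ℝ) := h1
        _ ≤ Real.exp (ε (φ' n) * (u (φ (φ' n)) : ℝ)) * (Real.exp (ε' n * (u (φ (φ' n)) : ℝ)) *
              ((sparseHighBridges d (u (φ (φ' n))) v δ'' (m - (j + 1))).card : ℝ)) := by
            gcongr
        _ = Real.exp ((ε (φ' n) + ε' n) * (u (φ (φ' n)) : ℝ)) *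
              ((sparseHighBridges d (u (φ (φ' n))) v δ'' (m - (j + 1))).card : ℝ) := by
            rw [add_mul, Real.exp_add]; ring
  -- `m ≥ 1`, so we may take `j = m - 1`
  have hm1 : 1 ≤ m := by
    rw [hm, Nat.one_le_ceil_iff]; positivity
  obtain ⟨δ, hδ, φ, hφ, ε, hε, hbound⟩ := iter (m - 1) (by omega)
  rw [show m - (m - 1) = 1 by omega] at hbound
  refine ⟨δ, hδ, φ, hφ, ε, hε, fun n => ?_⟩
  set N := u (φ n) with hN
  have hA : ((highBridges d N v).card : ℝ) ≤ (sparseHighBridges d N v (v / 2) m).card := by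
    exact_mod_cast card_le_card (highBridges_subset_sparseHighBridges hv N)
  have hC : ((sparseHighBridges d N v δ 1).card : ℝ) ≤
      ((highBridges d N v).filter fun ω => δ * (N : ℝ) ≤ (renewalCount N ω : ℝ)).card := by
    have hsub : sparseHighBridges d N v δ 1 ⊆
        (highBridges d N v).filter fun ω => δ * (N : ℝ) ≤ (renewalCount N ω : ℝ) := by
      intro ω hω
      rw [sparseHighBridges, mem_filter] at hω
      rw [mem_filter]
      refine ⟨hω.1, hω.2.trans ?_⟩
      have hωb : ω ∈ bridges d N := by
        have := hω.1; rw [highBridges, mem_filter] at this; exact this.1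
      exact_mod_cast sparseLevelCount_one_le_renewalCount hωb
    exact_mod_cast card_le_card hsub
  calc ((highBridges d N v).card : ℝ) ≤ (sparseHighBridges d N v (v / 2) m).card := hA
    _ ≤ Real.exp (ε n * (N : ℝ)) * ((sparseHighBridges d N v δ 1).card : ℝ) := hbound n
    _ ≤ Real.exp (ε n * (N : ℝ)) *
        (((highBridges d N v).filter fun ω => δ * (N : ℝ) ≤ (renewalCount N ω : ℝ)).card : ℝ) := by
        gcongr

/-- The skeleton's node K2 as a `Prop` (a-idea-2 Sketch_v8_DCH11, verbatim). [cite: DuminilCopinHammond2013, Thm 3.1 and Prop 3.2 (arXiv v1, p. 11)] -/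
def Thm31_of_prop32 : Prop := DCH_prop32 → DCH_thm31

/-- K2 holds. [cite: DuminilCopinHammond2013, proof of Thm 3.1 (arXiv v1, pp. 11–12)] -/
theorem thm31_of_prop32_holds : Thm31_of_prop32 := thm31_of_prop32

/-- The named `Prop` `Thm31_of_prop32` (K2), DISCHARGED under the exact `<Fact>_holds` name that the tree's
fact accounting keys on (same proof as `thm31_of_prop32_holds`).
[cite: DuminilCopinHammond2013, proof of Thm 3.1 (arXiv v1, pp. 11–12)] -/
theorem Thm31_of_prop32_holds : Thm31_of_prop32 := thm31_of_prop32


end Literature.Probability.RandomPlanarGeometry.SAW.Zd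

end
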